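import Literature.NumberTheory.LFunctions.LogFreeDensityLocal
import Literature.NumberTheory.LFunctions.ZetaLogDerivDisc
import HarnessLib

/-!
# Local tools for the log-free zero-density estimate, the case of `ζ`

Topic `Literature/NumberTheory/LFunctions`, sub-namespace `LogFreeDensity`. Everything here is
PROVED. The `ζ`-versions (with the entire function `ζ₁(s) = (s − 1)ζ(s)` of the tree's
`ZetaLogDerivDisc.lean` in place of `L(s, χ)`) of the Lemme de densité and of the Cauchy estimate
for the derivatives of the logarithmic derivative minus its local partial fraction
(`LogFreeDensityLocal.lean`), uniformly in the height `v`: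

* `exists_sum_near_le_zeta` — `∑_{ρ ∈ zetaDiscZeros v, |ρ − (1+iv)| ≤ r} m(ρ) ≤ C(1 + r log(|v|+4))`,
  `0 < r ≤ 1/4`;
* `exists_norm_iteratedDeriv_logDeriv_sub_le_zeta` — for `|s₀ − (2+iv)| ≤ 8/5`, `ζ₁(s₀) ≠ 0`,
  `‖(ζ₁'/ζ₁)^{(k)}(s₀) − (−1)^k k! ∑_{ρ ∈ zetaDiscZeros v} m(ρ)/(s₀ − ρ)^{k+1}‖ ≤ k! 16^k C log(|v|+4)`.

## References
* [Bombieri1987GrandCrible] §6, Lemme de densité (p. 42) and Lemme A (pp. 43–45), `χ = χ₀`.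
-/

noncomputable section

open Complex Metric Set Filter Finset
open scoped Real Topology

namespace Literature.NumberTheory.LFunctions.LogFreeDensity

open Literature.NumberTheory.LFunctions

/-- Zeros of `ζ` have real part `< 1`. [folklore] -/
theorem zeta_re_lt_one_of_mem {v : ℝ} {ρ : ℂ} (hρ : ρ ∈ zetaDiscZeros v) : ρ.re < 1 := by
  by_contra h
  exact riemannZeta_ne_zero_of_one_le_re (not_lt.1 h) (zetaDiscZeros_prop hρ).1

/-- **Lemme de densité for `ζ`** (Bombieri, *Le grand crible*, p. 42, the case `χ = χ₀`): there is an
absolute `C` such that for real `v` and `0 < r ≤ 1/4`, the zeros `ρ ∈ zetaDiscZeros v` of `ζ` with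
`|ρ − (1 + iv)| ≤ r` have `∑ m(ρ) ≤ C (1 + r log(|v| + 4))` (proof as for `L(s, χ)`, with
`ζ₁ = (s − 1)ζ`, `ζ₁'/ζ₁ = ζ'/ζ + 1/(s − 1)` and `|1/(s − 1)| ≤ 1/r` at `s = 1 + r + iv`).
[cite: Bombieri1987GrandCrible, §6 Lemme de densité] -/
theorem exists_sum_near_le_zeta :
    ∃ C : ℝ, 0 < C ∧ ∀ (v r : ℝ), 0 < r → r ≤ 1 / 4 →
        ∑ ρ ∈ (zetaDiscZeros v).filter (fun ρ => ‖ρ - (1 + (v : ℂ) * I)‖ ≤ r),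
            (zetaDiscDivisor v ρ : ℝ) ≤ C * (1 + r * Real.log (|v| + 4)) := by
  obtain ⟨C₁, hC₁, hpf⟩ := exists_norm_logDeriv_riemannZeta₁_sub_sum_le
  obtain ⟨K₀, hK₀, -, hLd⟩ := DirichletZFR.exists_norm_logDeriv_le
  refine ⟨8 + K₀ + 4 * C₁, by positivity, fun v r hr hr4 => ?_⟩
  classical
  set s : ℂ := (1 + r : ℝ) + (v : ℂ) * I with hs
  set ℒ : ℝ := Real.log (|v| + 4) with hℒ
  have hℒ1 : 1 ≤ ℒ := by rw [hℒ]; exact ClassicalZFRData.one_le_log_tau v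
  have hsre : s.re = 1 + r := by simp [hs]
  have hsim : s.im = v := by simp [hs]
  -- `s` lies in the disc `|s − (2 + iv)| ≤ 7/4` and `ζ₁(s) ≠ 0`
  have hsmem : s ∈ closedBall (2 + (v : ℂ) * I) (7 / 4) := by
    rw [mem_closedBall, dist_eq_norm]
    have : s - (2 + (v : ℂ) * I) = ((r - 1 : ℝ) : ℂ) := by rw [hs]; push_cast; ring
    rw [this, Complex.norm_real, Real.norm_eq_abs, abs_of_nonpos (by linarith)]
    linarith
  have hs1 : s ≠ 1 := by
    intro h; have := congr_arg Complex.re h; rw [hsre, one_re] at this; linarith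
  have hζs : riemannZeta s ≠ 0 := riemannZeta_ne_zero_of_one_le_re (by rw [hsre]; linarith)
  have hLs : riemannZeta₁ s ≠ 0 := fun h => hζs ((riemannZeta₁_eq_zero_iff hs1).1 h)
  have h1 := hpf v s hsmem hLs
  have h2 : ‖logDeriv riemannZeta₁ s‖ ≤ 2 / r + K₀ := by
    have hζ' : ‖logDeriv riemannZeta s‖ ≤ 1 / r + K₀ := by
      have := hLd 1 (1 : DirichletCharacter ℂ 1) s (by rw [hsre]; linarith)
      rw [hsre, min_eq_left (by linarith), DirichletCharacter.LFunction_modOne_eq] at this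
      rw [logDeriv_apply]
      simpa using this
    have heq : logDeriv riemannZeta₁ s = logDeriv riemannZeta s + (s - 1)⁻¹ := by
      rw [logDeriv_riemannZeta_eq hs1 hζs]; ring
    have hinv : ‖(s - 1)⁻¹‖ ≤ 1 / r := by
      rw [norm_inv, one_div]
      refine inv_anti₀ hr ?_
      have : (s - 1).re = r := by rw [sub_re, hsre, one_re]; ring
      calc r = |(s - 1).re| := by rw [this, abs_of_pos hr]
        _ ≤ ‖s - 1‖ := Complex.abs_re_le_norm _
    rw [heq]
    calc ‖logDeriv riemannZeta s + (s - 1)⁻¹‖ ≤ ‖logDeriv riemannZeta s‖ + ‖(s - 1)⁻¹‖ := norm_add_le _ _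
      _ ≤ (1 / r + K₀) + 1 / r := add_le_add hζ' hinv
      _ = 2 / r + K₀ := by ring
  -- `Re ∑ m/(s − ρ) ≤ 2/r + K₀ + C₁ ℒ`
  set Sz : ℂ := ∑ ρ ∈ zetaDiscZeros v, (zetaDiscDivisor v ρ : ℂ) / (s - ρ) with hSz
  have hA : ‖Sz‖ ≤ 2 / r + K₀ + C₁ * ℒ := by
    have hsplit : Sz = logDeriv riemannZeta₁ s - (logDeriv riemannZeta₁ s - Sz) := by ring
    calc ‖Sz‖ = ‖logDeriv riemannZeta₁ s - (logDeriv riemannZeta₁ s - Sz)‖ := by rw [← hsplit]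
      _ ≤ ‖logDeriv riemannZeta₁ s‖ + ‖logDeriv riemannZeta₁ s - Sz‖ := norm_sub_le _ _
      _ ≤ (2 / r + K₀) + C₁ * ℒ := add_le_add h2 h1
      _ = _ := by ring
  have hRe : Sz.re ≤ 2 / r + K₀ + C₁ * ℒ := (Complex.re_le_norm _).trans hA
  -- expand the real part termwise
  have hRe_eq : Sz.re = ∑ ρ ∈ zetaDiscZeros v, (zetaDiscDivisor v ρ : ℝ) * ((s - ρ)⁻¹).re := by
    rw [hSz, Complex.re_sum]
    refine Finset.sum_congr rfl fun ρ _ => ?_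
    rw [div_eq_mul_inv, show ((zetaDiscDivisor v ρ : ℤ) : ℂ) = (((zetaDiscDivisor v ρ : ℤ) : ℝ) : ℂ) by
      norm_cast, Complex.re_ofReal_mul]
  -- every term is `≥ 0`, the near terms are `≥ m/(4r)`
  have hterm0 : ∀ ρ ∈ zetaDiscZeros v, 0 ≤ (zetaDiscDivisor v ρ : ℝ) * ((s - ρ)⁻¹).re := by
    intro ρ hρ
    have hm : (0 : ℝ) ≤ zetaDiscDivisor v ρ := by exact_mod_cast zetaDiscDivisor_nonneg v ρ
    refine mul_nonneg hm (re_inv_sub_nonneg ?_)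
    rw [hsre]; linarith [(zeta_re_lt_one_of_mem hρ)]
  have hnear : ∀ ρ ∈ (zetaDiscZeros v).filter (fun ρ => ‖ρ - (1 + (v : ℂ) * I)‖ ≤ r),
      (zetaDiscDivisor v ρ : ℝ) * (1 / (4 * r)) ≤ (zetaDiscDivisor v ρ : ℝ) * ((s - ρ)⁻¹).re := by
    intro ρ hρ
    rw [Finset.mem_filter] at hρ
    have hm : (0 : ℝ) ≤ zetaDiscDivisor v ρ := by exact_mod_cast zetaDiscDivisor_nonneg v ρ
    refine mul_le_mul_of_nonneg_left ?_ hm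
    have hre : r ≤ (s - ρ).re := by
      rw [sub_re, hsre]; linarith [(zeta_re_lt_one_of_mem hρ.1)]
    have hnorm : ‖s - ρ‖ ≤ 2 * r := by
      calc ‖s - ρ‖ = ‖(s - (1 + (v : ℂ) * I)) + ((1 + (v : ℂ) * I) - ρ)‖ := by ring_nf
        _ ≤ ‖s - (1 + (v : ℂ) * I)‖ + ‖(1 + (v : ℂ) * I) - ρ‖ := norm_add_le _ _
        _ ≤ r + r := by
            refine add_le_add ?_ (by rw [norm_sub_rev]; exact hρ.2)
            have : s - (1 + (v : ℂ) * I) = ((r : ℝ) : ℂ) := by rw [hs]; push_cast; ring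
            rw [this, Complex.norm_real, Real.norm_eq_abs, abs_of_pos hr]
        _ = 2 * r := by ring
    have := re_inv_ge_of_re_ge_of_norm_le hr hre hnorm
    calc 1 / (4 * r) = r / (2 * r) ^ 2 := by field_simp; ring
      _ ≤ ((s - ρ)⁻¹).re := this
  -- combine
  have hsum : (∑ ρ ∈ (zetaDiscZeros v).filter (fun ρ => ‖ρ - (1 + (v : ℂ) * I)‖ ≤ r),
      (zetaDiscDivisor v ρ : ℝ)) * (1 / (4 * r)) ≤ 2 / r + K₀ + C₁ * ℒ := by
    rw [Finset.sum_mul]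
    calc ∑ ρ ∈ (zetaDiscZeros v).filter (fun ρ => ‖ρ - (1 + (v : ℂ) * I)‖ ≤ r),
          (zetaDiscDivisor v ρ : ℝ) * (1 / (4 * r))
        ≤ ∑ ρ ∈ (zetaDiscZeros v).filter (fun ρ => ‖ρ - (1 + (v : ℂ) * I)‖ ≤ r),
          (zetaDiscDivisor v ρ : ℝ) * ((s - ρ)⁻¹).re := Finset.sum_le_sum hnear
      _ ≤ ∑ ρ ∈ zetaDiscZeros v, (zetaDiscDivisor v ρ : ℝ) * ((s - ρ)⁻¹).re :=
          Finset.sum_le_sum_of_subset_of_nonneg (Finset.filter_subset _ _) fun ρ hρ _ => hterm0 ρ hρ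
      _ = Sz.re := hRe_eq.symm
      _ ≤ _ := hRe
  set N : ℝ := ∑ ρ ∈ (zetaDiscZeros v).filter (fun ρ => ‖ρ - (1 + (v : ℂ) * I)‖ ≤ r),
      (zetaDiscDivisor v ρ : ℝ) with hN
  have hN0 : 0 ≤ N := Finset.sum_nonneg fun ρ _ => by exact_mod_cast zetaDiscDivisor_nonneg v ρ
  rw [mul_one_div, div_le_iff₀ (by positivity)] at hsum
  -- `N ≤ 8 + 4 r K₀ + 4 r C₁ ℒ ≤ (8 + K₀ + 4C₁)(1 + rℒ)`
  have hrK : 4 * r * K₀ ≤ K₀ := by nlinarith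
  have hrℒ : 0 ≤ r * ℒ := by positivity
  calc N ≤ (2 / r + K₀ + C₁ * ℒ) * (4 * r) := hsum
    _ = 8 + 4 * r * K₀ + 4 * C₁ * (r * ℒ) := by field_simp; ring
    _ ≤ 8 + K₀ + 4 * C₁ * (r * ℒ) := by linarith
    _ ≤ (8 + K₀ + 4 * C₁) * (1 + r * ℒ) := by nlinarith

/-! ### The derivatives of `ζ₁'/ζ₁` near `σ = 1` -/

/-- **The derivatives of `ζ₁'/ζ₁` minus those of the local partial fraction** (as
`exists_norm_iteratedDeriv_logDeriv_sub_le`, for `ζ₁ = (s − 1)ζ`, all real `v`): there is an absolute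
`C` such that for `|s₀ − (2 + iv)| ≤ 8/5` with `ζ₁(s₀) ≠ 0` and every `k`,
`‖(ζ₁'/ζ₁)^{(k)}(s₀) − (−1)^k k! ∑_{ρ ∈ zetaDiscZeros v} m(ρ)/(s₀ − ρ)^{k+1}‖ ≤ k! 16^k C log(|v|+4)`.
[cite: Bombieri1987GrandCrible, §6 Lemme A (proof)] -/
theorem exists_norm_iteratedDeriv_logDeriv_sub_le_zeta :
    ∃ C : ℝ, 0 < C ∧ ∀ (v : ℝ),
      ∀ s₀ ∈ closedBall (2 + (v : ℂ) * I) (8 / 5), riemannZeta₁ s₀ ≠ 0 → ∀ k : ℕ,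
        ‖iteratedDeriv k (logDeriv riemannZeta₁) s₀ -
            (-1) ^ k * k.factorial *
              ∑ ρ ∈ zetaDiscZeros v, (zetaDiscDivisor v ρ : ℂ) / (s₀ - ρ) ^ (k + 1)‖ ≤
          k.factorial * 16 ^ k * (C * Real.log (|v| + 4)) := by
  obtain ⟨C₁, hC₁, hpf⟩ := exists_norm_logDeriv_riemannZeta₁_sub_sum_le
  refine ⟨C₁, hC₁, fun v s₀ hs₀ hL0 k => ?_⟩
  classical
  set c : ℂ := 2 + (v : ℂ) * I with hc
  set f := riemannZeta₁ with hf
  set ℒ : ℝ := Real.log (|v| + 4) with hℒ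
  have hfan : AnalyticOnNhd ℂ f (closedBall c (39 / 20)) :=
    fun z _ => differentiable_riemannZeta₁.analyticAt z
  have hfc : f c ≠ 0 := riemannZeta₁_two_add_ne_zero v
  obtain ⟨G, hGan, hGne, hfG⟩ := Literature.Analysis.Complex.exists_eq_prod_pow_sub_mul
    (R₂ := 37 / 20) (R := 39 / 20) (by norm_num) (by norm_num) hfan hfc
  -- the zero set and the weights are the tree's `zetaDiscZeros v`, `zetaDiscDivisor v`
  have hSeq : ((Function.locallyFinsuppWithin.finiteSupport (MeromorphicOn.divisor f (closedBall c (37 / 20)))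
      (isCompact_closedBall c (37 / 20))).toFinset) = zetaDiscZeros v := rfl
  have hDeq : MeromorphicOn.divisor f (closedBall c (37 / 20)) = zetaDiscDivisor v := rfl
  rw [hSeq, hDeq] at hfG
  set S := zetaDiscZeros v with hS
  set D := zetaDiscDivisor v with hD
  set n : ℂ → ℕ := fun u => (D u).toNat with hn
  set P : ℂ → ℂ := fun z => ∏ u ∈ S, (z - u) ^ n u with hP
  set Rem : ℂ → ℂ := logDeriv G with hRem
  set Sp : ℂ → ℂ := fun z => ∑ u ∈ S, (D u : ℂ) / (z - u) with hSp
  have hs₀mem : ‖s₀ - c‖ ≤ 8 / 5 := by rwa [mem_closedBall, dist_eq_norm] at hs₀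
  -- `Rem` is analytic on `|z − c| ≤ 37/20`
  have hRem_an : ∀ z ∈ closedBall c (37 / 20), AnalyticAt ℂ Rem z := by
    intro z hz
    have hGz := hGan z (closedBall_subset_closedBall (by norm_num) hz)
    rw [hRem]
    have : logDeriv G = fun w => deriv G w / G w := by funext w; rw [logDeriv_apply]
    rw [this]
    exact hGz.deriv.div hGz (hGne z hz)
  -- off the zeros inside `|z − c| < 7/4`: `ζ₁'/ζ₁ = Sp + Rem`
  have hident : ∀ z ∈ ball c (7 / 4), z ∉ S → logDeriv f z = Sp z + Rem z := by
    intro z hz hzS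
    have hz81 : z ∈ closedBall c (37 / 20) := by
      rw [mem_ball] at hz; rw [mem_closedBall]; linarith
    have hfz : f z ≠ 0 := fun h0 => hzS (mem_zetaDiscZeros.2 ⟨hz81, h0⟩)
    have hz' : ∀ u ∈ S, z ≠ u := fun u hu h => hzS (h ▸ hu)
    -- `f = P G` near `z`
    have hnhds : closedBall c (39 / 20) ∈ 𝓝 z := by
      refine mem_of_superset (isOpen_ball.mem_nhds hz) ?_
      exact ball_subset_closedBall.trans (closedBall_subset_closedBall (by norm_num))
    have hev : f =ᶠ[𝓝 z] fun w => P w * G w :=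
      Filter.eventually_of_mem hnhds fun w hw => by rw [hfG w hw]
    have h1 : logDeriv f z = logDeriv (fun w => P w * G w) z := by
      rw [logDeriv_apply, logDeriv_apply, hev.deriv_eq, hev.eq_of_nhds]
    have hPz : P z ≠ 0 := Literature.Analysis.Complex.prod_pow_sub_ne_zero n hz'
    have hGz : G z ≠ 0 := hGne z hz81
    have hPd : DifferentiableAt ℂ P z := by
      rw [hP]
      exact DifferentiableAt.fun_finsetProd fun u _ => (differentiableAt_id.sub_const u).pow (n u)
    have hGd : DifferentiableAt ℂ G z := (hGan z (closedBall_subset_closedBall (by norm_num) hz81)).differentiableAt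
    rw [h1, logDeriv_mul z hPz hGz hPd hGd]
    congr 1
    rw [logDeriv_apply, hP]
    rw [Literature.Analysis.Complex.deriv_prod_pow_sub_div n hz', hSp]
    refine Finset.sum_congr rfl fun u _ => ?_
    have h0 : 0 ≤ D u := zetaDiscDivisor_nonneg v u
    rw [hn]; dsimp only
    rw [show ((D u).toNat : ℂ) = (((D u).toNat : ℤ) : ℂ) by norm_cast, Int.toNat_of_nonneg h0]
  -- `s₀ ∉ S`, and the identity holds near `s₀`
  have hs₀S : s₀ ∉ S := fun h => hL0 (mem_zetaDiscZeros.1 h).2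
  have hs₀ball : s₀ ∈ ball c (7 / 4) := by rw [mem_ball, dist_eq_norm]; linarith
  have hV : (ball c (7 / 4) \ (↑S : Set ℂ)) ∈ 𝓝 s₀ :=
    (isOpen_ball.sdiff S.finite_toSet.isClosed).mem_nhds ⟨hs₀ball, hs₀S⟩
  have hevs₀ : logDeriv f =ᶠ[𝓝 s₀] Sp + Rem :=
    Filter.eventually_of_mem hV fun z hz => by rw [Pi.add_apply]; exact hident z hz.1 hz.2
  -- smoothness at `s₀`
  have hSp_cd : ContDiffAt ℂ k Sp s₀ := by
    rw [hSp]
    refine ContDiffAt.sum fun u hu => ?_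
    exact contDiffAt_const.div (contDiffAt_id.sub contDiffAt_const)
      (sub_ne_zero.2 fun h => hs₀S (h ▸ hu))
  have hRem_cd : ContDiffAt ℂ k Rem s₀ :=
    (hRem_an s₀ (by rw [mem_closedBall, dist_eq_norm]; linarith)).contDiffAt
  have hsplit : iteratedDeriv k (logDeriv f) s₀ = iteratedDeriv k Sp s₀ + iteratedDeriv k Rem s₀ := by
    rw [hevs₀.iteratedDeriv_eq, iteratedDeriv_add hSp_cd hRem_cd]
  have hSp_der : iteratedDeriv k Sp s₀ =
      (-1) ^ k * k.factorial * ∑ ρ ∈ S, (D ρ : ℂ) / (s₀ - ρ) ^ (k + 1) :=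
    iteratedDeriv_sum_div_sub S (fun u => (D u : ℂ)) k hs₀S
  -- a radius `r₁ ∈ [1/16, 1/8]` whose circle about `s₀` avoids the zeros
  obtain ⟨r₁, hr₁mem, hr₁S⟩ := (Set.Icc_infinite (show (1 / 16 : ℝ) < 1 / 8 by norm_num)).exists_notMem_finset
    (S.image fun u => ‖u - s₀‖)
  have hr₁pos : 0 < r₁ := by linarith [hr₁mem.1]
  -- `Rem` is bounded by `C₁ ℒ` on that circle
  have hbound : ∀ z ∈ sphere s₀ r₁, ‖Rem z‖ ≤ C₁ * ℒ := by
    intro z hz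
    rw [mem_sphere, dist_eq_norm] at hz
    have hzc : ‖z - c‖ < 7 / 4 := by
      calc ‖z - c‖ = ‖(z - s₀) + (s₀ - c)‖ := by ring_nf
        _ ≤ ‖z - s₀‖ + ‖s₀ - c‖ := norm_add_le _ _
        _ < 7 / 4 := by rw [hz]; linarith [hr₁mem.2]
    have hzball : z ∈ ball c (7 / 4) := by rw [mem_ball, dist_eq_norm]; exact hzc
    have hzS : z ∉ S := by
      intro hzS
      apply hr₁S
      rw [Finset.mem_image]
      exact ⟨z, hzS, hz⟩
    have hz81 : z ∈ closedBall c (37 / 20) := by rw [mem_closedBall, dist_eq_norm]; linarith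
    have hfz : f z ≠ 0 := fun h0 => hzS (mem_zetaDiscZeros.2 ⟨hz81, h0⟩)
    have h := hpf v z (by rw [mem_closedBall, dist_eq_norm]; exact hzc.le) hfz
    have heq : Rem z = logDeriv f z - Sp z := by rw [hident z hzball hzS]; ring
    rw [heq]
    exact h
  -- Cauchy's estimate for `Rem` on `|z − s₀| ≤ r₁`
  have hdiff : DiffContOnCl ℂ Rem (ball s₀ r₁) := by
    refine DifferentiableOn.diffContOnCl ?_
    rw [closure_ball s₀ hr₁pos.ne']
    intro z hz
    refine (hRem_an z ?_).differentiableAt.differentiableWithinAt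
    rw [mem_closedBall, dist_eq_norm] at hz ⊢
    calc ‖z - c‖ = ‖(z - s₀) + (s₀ - c)‖ := by ring_nf
      _ ≤ ‖z - s₀‖ + ‖s₀ - c‖ := norm_add_le _ _
      _ ≤ 37 / 20 := by linarith [hr₁mem.2]
  have hC := Complex.norm_iteratedDeriv_le_of_forall_mem_sphere_norm_le k hr₁pos hdiff hbound
  -- assemble
  rw [hsplit, hSp_der, add_sub_cancel_left]
  refine hC.trans ?_
  have hℒ0 : 0 ≤ C₁ * ℒ := mul_nonneg hC₁.le (by rw [hℒ]; linarith [ClassicalZFRData.one_le_log_tau v])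
  have hfac : (0 : ℝ) ≤ k.factorial := by positivity
  rw [div_eq_mul_inv, ← inv_pow]
  have hinv : r₁⁻¹ ≤ 16 := by
    rw [inv_le_comm₀ hr₁pos (by norm_num)]
    linarith [hr₁mem.1]
  have hpow : r₁⁻¹ ^ k ≤ 16 ^ k := pow_le_pow_left₀ (inv_nonneg.2 hr₁pos.le) hinv k
  calc (k.factorial : ℝ) * (C₁ * ℒ) * r₁⁻¹ ^ k = k.factorial * r₁⁻¹ ^ k * (C₁ * ℒ) := by ring
    _ ≤ k.factorial * 16 ^ k * (C₁ * ℒ) := by gcongr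

end Literature.NumberTheory.LFunctions.LogFreeDensity
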